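import Literature.Analysis.FluidPDE.PassiveScalarBoundedRemainder
import HarnessLib

/-!
# Energy identity for BOUNDED passive scalars along `L²` drifts, III: the energy EQUALITY

Analysis/FluidPDE proof file (everything proved; no definitions, no named facts), third of the files
discharging `MescoliniPitchoSorella2025_thm24` (Mescolini–Pitcho–Sorella, Ann. Mat. Pura Appl. 204
(2025), Thm. 2.4). For a weak solution `θ` of `∂ₜθ + u·∇θ = κΔθ` on `T^d × [0,T)` with datum
`θ₀ ∈ L²` (`Torus.IsWeakScalarTransportOn T κ u θ₀ θ`, any real `κ`) in the class of Thm. 2.4 —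
BOUNDED, `|θ| ≤ M` a.e. on `(0,T) × T^d`, with `∫₀ᵀ ‖∇θ‖²_{L²} < ∞` — along a drift
`u ∈ L²((0,T) × T^d)` (weakly divergence free at a.e. time, part of the class):

* `energy_eq_of_molInt_identity` — **the deterministic core**: at a time `t ∈ (0,T]` and for a slice
  `δ ∈ L²` at which the mollified energy identities
  `‖δ ⋆ kₙ‖² = ‖θ₀ ⋆ kₙ‖² + 2∫₀ᵗ ∫ Aₙ Gₙ` hold for all `n` (`kₙ = kernel (1/(4(n+1)))`,
  `PassiveScalarEnergyMollified`), the energy EQUALITY `‖δ‖² + 2κ ∫₀ᵗ ‖∇θ‖² = ‖θ₀‖²` holds —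
  letting `n → ∞`: `‖δ ⋆ kₙ‖ → ‖δ‖`, `‖θ₀ ⋆ kₙ‖ → ‖θ₀‖`; the flux splits as
  `∫ Aₙ Gₙ = Xₙ - κ‖∇Aₙ‖²` with `|∫₀ᵗ Xₙ| ≤ ‖Rₙ‖_{L²_t} ‖∇θ‖_{L²_{t,x}} → 0`
  (`PassiveScalarBoundedSlice.enorm_integral_conv_mul_flux_add_le`, Hölder in time,
  `PassiveScalarBoundedRemainder.tendsto_lintegral_remainder_sq`) and
  `∫₀ᵗ ‖∇Aₙ‖² → ∫₀ᵗ ‖∇θ‖²` by dominated convergence (`‖∇(θ ⋆ kₙ)‖ ≤ ‖∇θ‖` slice-wise,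
  `PassiveScalarBoundedRemainder.tendsto_eScalarGradNormSq_convolution_kernel`);
* `ae_energy_eq_of_abs_le` — **the energy equality at a.e. time**: for a.e. `t ∈ (0,T)`,
  `‖θ(t)‖²_{L²} + 2κ ∫₀ᵗ ‖∇θ(s)‖²_{L²} ds = ‖θ₀‖²_{L²}` — the equality case "(2.3)" of Thm. 2.4
  (printed as an inequality; equality holds, Bonicatto–Ciampa–Crippa 2024, Remark 3.4), for EVERY
  solution of the class, not only the constructed one.

The every-time form for the `L²`-continuous representative, strong continuity and uniqueness are in
the sequel `PassiveScalarBoundedContinuity`.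

## Mathlib / tree search

Tree (reused by name): `ae_integral_sq_molInt_eq`, `integrableOn_integral_conv_mul_flux`
(`PassiveScalarEnergyMollified`), `aemeasurable_eLpNorm_norm_conv_gradient`,
`aestronglyMeasurable_integral_norm_sq_conv_gradient` (`PassiveScalarEnergyProofs`),
`tendsto_lintegral_enorm_sq_of_tendsto_eLpNorm_sub` (`PassiveScalarEnergyPointwise`),
`eScalarGradNormSq_eq_ofReal_integral`, `aemeasurable_eScalarGradNormSq` (`PassiveScalarSpectralBounds`),
and the two files I–II of this series. Mathlib: `tendsto_integral_of_dominated_convergence`,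
`integral_toReal`, `integrable_toReal_of_lintegral_ne_top`, `ENNReal.lintegral_mul_le_Lp_mul_Lq`.

## References

* G. Mescolini, J. Pitcho, M. Sorella, Ann. Mat. Pura Appl. (4) 204 (2025) 1667–1687, Thm. 2.4 and
  (2.3), proof pp. 1671–1674. [`MescoliniPitchoSorella2025`]
* P. Bonicatto, G. Ciampa, G. Crippa, J. Evol. Equ. 24 (2024), Paper No. 1, Thm. 3.3, (3.4),
  Remark 3.4. [`BonicattoCiampaCrippa2023`]
-/

noncomputable section

open MeasureTheory TopologicalSpace Set Function Filter Metric ContinuousLinearMap UnitAddTorus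
open _root_.Topology
open scoped ENNReal NNReal Convolution ContDiff InnerProductSpace

namespace Literature.Analysis.FluidPDE

namespace Torus

variable {d : Type*} [Fintype d]

/-- `‖f‖_{L²}² = ∫⁻ ‖f‖ₑ²` (any normed group). [folklore] -/
private theorem eLpNorm_two_pow_two'' {α : Type*} [MeasurableSpace α] {μ : Measure α}
    {E : Type*} [NormedAddCommGroup E] (f : α → E) :
    eLpNorm f 2 μ ^ 2 = ∫⁻ x, ‖f x‖ₑ ^ 2 ∂μ := by
  rw [eLpNorm_eq_lintegral_rpow_enorm_toReal two_ne_zero ENNReal.ofNat_ne_top]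
  simp only [ENNReal.toReal_ofNat, one_div]
  rw [← ENNReal.rpow_natCast, ← ENNReal.rpow_mul]
  norm_num

/-- `∫⁻ ‖f‖ₑ² = ofReal (∫ f²)` for a real `f ∈ L²(T^d)`. [folklore] -/
private theorem lintegral_enorm_sq_eq_ofReal_sq₃ {f : UnitAddTorus d → ℝ} (hf : MemLp f 2 volume) :
    ∫⁻ x, ‖f x‖ₑ ^ 2 = ENNReal.ofReal (∫ x, f x ^ 2) := by
  rw [ofReal_integral_eq_lintegral_ofReal (hf.integrable_norm_pow two_ne_zero |>.congr
    (ae_of_all _ fun x => by simp [sq_abs])) (ae_of_all _ fun x => by positivity)]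
  refine lintegral_congr_ae (ae_of_all _ fun x => ?_)
  show ‖f x‖ₑ ^ 2 = ENNReal.ofReal (f x ^ 2)
  rw [← sq_abs, ENNReal.ofReal_pow (abs_nonneg _), ← Real.enorm_eq_ofReal_abs]

/-- **`‖f ⋆ kₙ‖²_{L²} → ‖f‖²_{L²}`** (real form) along the torus kernels, for `f ∈ L²(T^d)`. [folklore] -/
private theorem tendsto_integral_sq_conv_kernel {f : UnitAddTorus d → ℝ} (hf : MemLp f 2 volume) :
    Tendsto (fun n : ℕ => ∫ x, (f ⋆ FunctionSpaces.Torus.kernel (1 / (4 * ((n : ℝ) + 1)))) x ^ 2) atTop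
      (𝓝 (∫ x, f x ^ 2)) := by
  obtain ⟨hε, hε', hε0⟩ := molRadius_spec
  have hfi : Integrable f volume := hf.integrable one_le_two
  have hkS : ∀ n : ℕ, FunctionSpaces.Torus.IsSmooth (FunctionSpaces.Torus.kernel (d := d) (1 / (4 * ((n : ℝ) + 1)))) :=
    fun n => FunctionSpaces.Torus.isSmooth_kernel (hε n) (hε' n)
  have hE0 : Tendsto (fun n : ℕ => eLpNorm (f ⋆ FunctionSpaces.Torus.kernel (1 / (4 * ((n : ℝ) + 1))) - f) 2 volume)
      atTop (𝓝 0) :=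
    FunctionSpaces.Torus.tendsto_eLpNorm_convolution_sub_self hf
      (fun n y => FunctionSpaces.Torus.kernel_nonneg (hε n).le y)
      (fun n => FunctionSpaces.Torus.integral_kernel (hε n) (hε' n))
      (fun n => FunctionSpaces.Torus.support_kernel_subset (hε n))
      (fun n => FunctionSpaces.Torus.continuous_kernel (hε n) (hε' n)) hε0
  have hlim := tendsto_lintegral_enorm_sq_of_tendsto_eLpNorm_sub
    (fun n => (FunctionSpaces.Torus.continuous_convolution hfi (hkS n).continuous).aestronglyMeasurable) hf hE0
  have hfin : ∫⁻ x, ‖f x‖ₑ ^ 2 ≠ ⊤ := by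
    rw [lintegral_enorm_sq_eq_ofReal_sq₃ hf]; exact ENNReal.ofReal_ne_top
  have h2 := (ENNReal.tendsto_toReal hfin).comp hlim
  rw [lintegral_enorm_sq_eq_ofReal_sq₃ hf, ENNReal.toReal_ofReal (integral_nonneg fun x => sq_nonneg _)] at h2
  refine h2.congr fun n => ?_
  rw [Function.comp_apply, lintegral_enorm_sq_eq_ofReal_integral_sq
    (FunctionSpaces.Torus.continuous_convolution hfi (hkS n).continuous),
    ENNReal.toReal_ofReal (integral_nonneg fun x => sq_nonneg _)]

namespace IsWeakScalarTransportOn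

variable {T κ : ℝ} {u : ℝ → UnitAddTorus d → EuclideanSpace ℝ d} {θ₀ : UnitAddTorus d → ℝ}
  {θ : ℝ → UnitAddTorus d → ℝ}

/-- **The good slices of a bounded weak solution along an `L²` drift**: for a.e. `s ∈ (0,T)`,
`θ(s) ∈ L¹ ∩ L²` with the class bound, `u(s) ∈ L²` (hence integrable), `u(s)` weakly divergence
free, `|θ(s)| ≤ M` a.e., and `‖∇θ(s)‖² < ∞`. [folklore] -/
private theorem ae_good_slice (h : IsWeakScalarTransportOn T κ u θ₀ θ) {M : ℝ}
    (hθb : ∀ᵐ t ∂(volume.restrict (Ioo 0 T)), ∀ᵐ x ∂(volume : Measure (UnitAddTorus d)), |θ t x| ≤ M)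
    (hu2 : ∫⁻ t in Ioo 0 T, ∫⁻ x, ‖u t x‖ₑ ^ 2 < ⊤)
    (hD : ∫⁻ t in Ioo 0 T, eScalarGradNormSq (θ t) < ⊤) :
    ∀ᵐ s ∂(volume.restrict (Ioo 0 T)), Integrable (θ s) volume ∧ Integrable (u s) volume ∧
      FunctionSpaces.Torus.IsWeaklyDivFree (u s) ∧ MemLp (θ s) 2 volume ∧
      (∀ᵐ x ∂(volume : Measure (UnitAddTorus d)), |θ s x| ≤ M) ∧ eScalarGradNormSq (θ s) < ⊤ := by
  have hu2ae : ∀ᵐ s ∂(volume.restrict (Ioo 0 T)), ∫⁻ x, ‖u s x‖ₑ ^ 2 < ⊤ :=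
    ae_lt_top' (h.aestronglyMeasurable_uncurry_velocity.aemeasurable.enorm.pow_const 2).lintegral_prod_right' hu2.ne
  have hDae : ∀ᵐ s ∂(volume.restrict (Ioo 0 T)), eScalarGradNormSq (θ s) < ⊤ :=
    ae_lt_top' h.aemeasurable_eScalarGradNormSq hD.ne
  filter_upwards [h.ae_slice_integrable₁, hu2ae, h.ae_isWeaklyDivFree, h.ae_memLp_two, hθb, hDae]
    with s h1 h2 h3 h4 h5 h6
  have hne : eLpNorm (u s) 2 volume < ⊤ := by
    have hsq : eLpNorm (u s) 2 volume ^ 2 < ⊤ := by rw [eLpNorm_two_pow_two'']; exact h2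
    by_contra htop
    rw [not_lt, top_le_iff] at htop
    rw [htop] at hsq
    simp at hsq
  have hu : MemLp (u s) 2 volume := ⟨h1.2.1, hne⟩
  exact ⟨h1.1, hu.integrable one_le_two, h3, h4, h5, h6⟩

/-- **The energy EQUALITY from the mollified identities (deterministic core).** Let `θ` be a weak
solution of `∂ₜθ + u·∇θ = κΔθ` on `T^d × [0,T)` with datum `θ₀ ∈ L²`, BOUNDED (`|θ| ≤ M` a.e. on
`(0,T) × T^d`), with `∫₀ᵀ ‖∇θ‖² < ∞`, along a drift `u ∈ L²((0,T) × T^d)`. If at a time `t ∈ (0,T]`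
a slice `δ ∈ L²(T^d)` satisfies, for every `n`, the mollified energy identity
`∫ (δ ⋆ kₙ)² = ∫ (θ₀ ⋆ kₙ)² + 2 ∫_{(0,t]} ∫ Aₙ Gₙ` (`kₙ = kernel (1/(4(n+1)))`, `Aₙ = θ ⋆ kₙ`, `Gₙ` the
mollified flux), then `‖δ‖²_{L²} + 2κ ∫₀ᵗ ‖∇θ‖²_{L²} = ‖θ₀‖²_{L²}`: the limit `n → ∞` of the
identities, the transport remainder being `≤ ‖Rₙ‖_{L²_t} ‖∇θ‖_{L²_{t,x}} → 0` and the dissipation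
term converging by dominated convergence. This is the proof of (2.3) in Mescolini–Pitcho–Sorella
2025, Thm. 2.4, with equality (Bonicatto–Ciampa–Crippa 2024, Remark 3.4), for the corner `p = 2`,
`q = ∞`. [cite: MescoliniPitchoSorella2025, Thm. 2.4 (2.3), proof pp. 1671–1674] -/
theorem energy_eq_of_molInt_identity (h : IsWeakScalarTransportOn T κ u θ₀ θ) (hθ₀ : MemLp θ₀ 2 volume)
    {M : ℝ} (hθb : ∀ᵐ t ∂(volume.restrict (Ioo 0 T)), ∀ᵐ x ∂(volume : Measure (UnitAddTorus d)), |θ t x| ≤ M)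
    (hu2 : ∫⁻ t in Ioo 0 T, ∫⁻ x, ‖u t x‖ₑ ^ 2 < ⊤)
    (hD : ∫⁻ t in Ioo 0 T, eScalarGradNormSq (θ t) < ⊤)
    {t : ℝ} (ht : t ∈ Ioc 0 T) {δ : UnitAddTorus d → ℝ} (hδ : MemLp δ 2 volume)
    (hid : ∀ n : ℕ, ∫ x, (δ ⋆ FunctionSpaces.Torus.kernel (1 / (4 * ((n : ℝ) + 1)))) x ^ 2 =
      (∫ x, (θ₀ ⋆ FunctionSpaces.Torus.kernel (1 / (4 * ((n : ℝ) + 1)))) x ^ 2) +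
        2 * ∫ s in Ioc 0 t, ∫ x, ((θ s) ⋆ FunctionSpaces.Torus.kernel (1 / (4 * ((n : ℝ) + 1)))) x *
          ∫ y, θ s y * (-⟪u s y, FunctionSpaces.Torus.gradient (FunctionSpaces.Torus.kernel (1 / (4 * ((n : ℝ) + 1)))) (x - y)⟫_ℝ +
            κ * FunctionSpaces.Torus.laplacian (FunctionSpaces.Torus.kernel (1 / (4 * ((n : ℝ) + 1)))) (x - y))) :
    (∫ x, δ x ^ 2) + 2 * κ * (∫⁻ s in Ioo 0 t, eScalarGradNormSq (θ s)).toReal = ∫ x, θ₀ x ^ 2 := by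
  set μT : Measure ℝ := (volume : Measure ℝ).restrict (Ioo 0 T) with hμT
  haveI : IsFiniteMeasure μT := by rw [hμT]; infer_instance
  obtain ⟨hε, hε', hε0⟩ := molRadius_spec
  set ε : ℕ → ℝ := fun n => 1 / (4 * ((n : ℝ) + 1)) with hε_def
  have hkS : ∀ n, FunctionSpaces.Torus.IsSmooth (FunctionSpaces.Torus.kernel (d := d) (ε n)) :=
    fun n => FunctionSpaces.Torus.isSmooth_kernel (hε n) (hε' n)
  have hθ₀i : Integrable θ₀ volume := hθ₀.integrable one_le_two
  have hsub : Ioo 0 t ⊆ Ioo 0 T := Ioo_subset_Ioo_right ht.2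
  set μt : Measure ℝ := (volume : Measure ℝ).restrict (Ioo 0 t) with hμt
  have hle_t : μt ≤ μT := Measure.restrict_mono_set _ hsub
  have hgood := h.ae_good_slice hθb hu2 hD
  -- the mollified quantities
  set N : ℕ → ℝ → ℝ≥0∞ := fun n s =>
    eLpNorm (fun x => ‖(θ s ⋆ FunctionSpaces.Torus.gradient (FunctionSpaces.Torus.kernel (ε n))) x‖) 2 volume with hN_def
  set g : ℕ → ℝ → ℝ := fun n s =>
    ∫ x, ‖(θ s ⋆ FunctionSpaces.Torus.gradient (FunctionSpaces.Torus.kernel (ε n))) x‖ ^ 2 with hg_def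
  set Φ : ℕ → ℝ → ℝ := fun n s => ∫ x, (θ s ⋆ FunctionSpaces.Torus.kernel (ε n)) x * ∫ y, θ s y *
    (-⟪u s y, FunctionSpaces.Torus.gradient (FunctionSpaces.Torus.kernel (ε n)) (x - y)⟫_ℝ +
      κ * FunctionSpaces.Torus.laplacian (FunctionSpaces.Torus.kernel (ε n)) (x - y)) with hΦ_def
  set RR : ℕ → ℝ → ℝ≥0∞ := fun n s => eLpNorm (fun y =>
    (θ s - (θ s ⋆ FunctionSpaces.Torus.kernel (ε n)) ⋆ FunctionSpaces.Torus.kernel (ε n)) y * ‖u s y‖) 2 volume with hRR_def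
  have hNm : ∀ n, AEMeasurable (N n) μT := fun n => h.aemeasurable_eLpNorm_norm_conv_gradient (hkS n)
  have hgm : ∀ n, AEStronglyMeasurable (g n) μT := fun n =>
    h.aestronglyMeasurable_integral_norm_sq_conv_gradient (hkS n)
  have hRRm : ∀ n, AEMeasurable (RR n) μT := fun n => h.aemeasurable_eLpNorm_remainder (hkS n).continuous
  have hg0 : ∀ n s, 0 ≤ g n s := fun n s => integral_nonneg fun x => sq_nonneg _
  -- the spectral norm of the mollified slice at good times
  have hgradN : ∀ n, ∀ᵐ s ∂μT, eScalarGradNormSq (θ s ⋆ FunctionSpaces.Torus.kernel (ε n)) = ENNReal.ofReal (g n s) := by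
    intro n
    filter_upwards [hgood] with s hs
    have hA : FunctionSpaces.Torus.IsSmooth (θ s ⋆ FunctionSpaces.Torus.kernel (ε n)) :=
      FunctionSpaces.Torus.isSmooth_convolution hs.1 (hkS n)
    have hgrad : ∀ x, FunctionSpaces.Torus.gradient (θ s ⋆ FunctionSpaces.Torus.kernel (ε n)) x =
        (θ s ⋆ FunctionSpaces.Torus.gradient (FunctionSpaces.Torus.kernel (ε n))) x :=
      fun x => FunctionSpaces.Torus.gradient_convolution hs.1 (hkS n) x
    rw [eScalarGradNormSq_eq_ofReal_integral hA]
    simp only [hgrad, hg_def]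
  have hN2 : ∀ n, ∀ᵐ s ∂μT, N n s ^ 2 = ENNReal.ofReal (g n s) := by
    intro n
    filter_upwards [hgood] with s hs
    have hc : Continuous fun x => ‖(θ s ⋆ FunctionSpaces.Torus.gradient (FunctionSpaces.Torus.kernel (ε n))) x‖ :=
      (FunctionSpaces.Torus.continuous_convolution hs.1 (hkS n).gradient.continuous).norm
    simp only [hN_def, hg_def]
    rw [PassiveScalarProofs.eLpNorm_two_pow_two, lintegral_enorm_sq_eq_ofReal_integral_sq hc]
  -- `gₙ ≤ ‖∇θ‖²` a.e. and `gₙ → ‖∇θ‖²` a.e.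
  have hgle : ∀ n, ∀ᵐ s ∂μT, g n s ≤ (eScalarGradNormSq (θ s)).toReal := by
    intro n
    filter_upwards [hgood, hgradN n] with s hs hsN
    have h1 : ENNReal.ofReal (g n s) ≤ eScalarGradNormSq (θ s) := by
      rw [← hsN]
      exact eScalarGradNormSq_convolution_kernel_le hs.1 (hε n) (hε' n)
    exact (ENNReal.ofReal_le_iff_le_toReal hs.2.2.2.2.2.ne).1 h1
  have hglim : ∀ᵐ s ∂μT, Tendsto (fun n => g n s) atTop (𝓝 (eScalarGradNormSq (θ s)).toReal) := by
    filter_upwards [hgood, ae_all_iff.2 hgradN] with s hs hsN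
    have h1 := (ENNReal.tendsto_toReal hs.2.2.2.2.2.ne).comp
      (tendsto_eScalarGradNormSq_convolution_kernel hs.1 hε hε' hε0)
    refine h1.congr fun n => ?_
    rw [Function.comp_apply, hsN n, ENNReal.toReal_ofReal (hg0 n s)]
  have hGi : Integrable (fun s => (eScalarGradNormSq (θ s)).toReal) μT :=
    integrable_toReal_of_lintegral_ne_top h.aemeasurable_eScalarGradNormSq hD.ne
  have hgi : ∀ n, Integrable (g n) μT := fun n =>
    hGi.mono' (hgm n) ((hgle n).mono fun s hs => by
      rw [Real.norm_eq_abs, abs_of_nonneg (hg0 n s)]; exact hs)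
  -- `∫ Nₙ² ≤ D`
  have hND : ∀ n, ∫⁻ s, N n s ^ 2 ∂μT ≤ ∫⁻ s, eScalarGradNormSq (θ s) ∂μT := by
    intro n
    refine lintegral_mono_ae ?_
    filter_upwards [hN2 n, hgradN n, hgood] with s h2 hN hs
    rw [h2, ← hN]
    exact eScalarGradNormSq_convolution_kernel_le hs.1 (hε n) (hε' n)
  -- the cross term: `‖∫_{(0,t)} (Φₙ + κ gₙ)‖ₑ ≤ cₙ → 0`
  set c : ℕ → ℝ≥0∞ := fun n => (∫⁻ s, RR n s ^ 2 ∂μT) ^ (1 / 2 : ℝ) *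
    (∫⁻ s, eScalarGradNormSq (θ s) ∂μT) ^ (1 / 2 : ℝ) with hc_def
  have hRfin : ∀ n, ∫⁻ s, RR n s ^ 2 ∂μT ≠ ⊤ := fun n =>
    ((h.lintegral_remainder_sq_le hθb (hε n) (hε' n)).trans_lt
      (ENNReal.mul_lt_top ENNReal.ofReal_lt_top hu2)).ne
  have hct : ∀ n, c n ≠ ⊤ := fun n =>
    ENNReal.mul_ne_top (ENNReal.rpow_ne_top_of_nonneg (by norm_num) (hRfin n))
      (ENNReal.rpow_ne_top_of_nonneg (by norm_num) hD.ne)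
  have hc0 : Tendsto c atTop (𝓝 0) := by
    have h1 := (h.tendsto_lintegral_remainder_sq hθb hu2).ennrpow_const (1 / 2 : ℝ)
    rw [ENNReal.zero_rpow_of_pos (by norm_num)] at h1
    have h2 := ENNReal.Tendsto.mul_const h1 (Or.inr (ENNReal.rpow_ne_top_of_nonneg (by norm_num) hD.ne) :
      (0 : ℝ≥0∞) ≠ 0 ∨ (∫⁻ s, eScalarGradNormSq (θ s) ∂μT) ^ (1 / 2 : ℝ) ≠ ⊤)
    rw [zero_mul] at h2
    exact h2
  have hX : ∀ n, ‖∫ s in Ioo 0 t, (Φ n s + κ * g n s)‖ₑ ≤ c n := by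
    intro n
    have hH : ∫⁻ s, RR n s * N n s ∂μT ≤ (∫⁻ s, RR n s ^ 2 ∂μT) ^ (1 / 2 : ℝ) *
        (∫⁻ s, N n s ^ 2 ∂μT) ^ (1 / 2 : ℝ) := by
      have hH' := ENNReal.lintegral_mul_le_Lp_mul_Lq μT Real.HolderConjugate.two_two (hRRm n) (hNm n)
      have e1 : ∫⁻ s, RR n s ^ 2 ∂μT = ∫⁻ s, RR n s ^ (2 : ℝ) ∂μT :=
        lintegral_congr fun s => by rw [ENNReal.rpow_two]
      have e2 : ∫⁻ s, N n s ^ 2 ∂μT = ∫⁻ s, N n s ^ (2 : ℝ) ∂μT :=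
        lintegral_congr fun s => by rw [ENNReal.rpow_two]
      rw [e1, e2]
      exact hH'
    calc ‖∫ s in Ioo 0 t, (Φ n s + κ * g n s)‖ₑ ≤ ∫⁻ s in Ioo 0 t, ‖Φ n s + κ * g n s‖ₑ :=
          enorm_integral_le_lintegral_enorm _
      _ ≤ ∫⁻ s in Ioo 0 T, ‖Φ n s + κ * g n s‖ₑ := lintegral_mono_set hsub
      _ ≤ ∫⁻ s, RR n s * N n s ∂μT := by
          refine lintegral_mono_ae ?_
          filter_upwards [hgood] with s hs
          have hslice := enorm_integral_conv_mul_flux_add_le (δ := θ s) (v := u s) (ε := ε n) hs.1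
            hs.2.2.2.2.1 hs.2.1 hs.2.2.1 (hε n) (hε' n) κ
          have hgrad : ∀ x, FunctionSpaces.Torus.gradient (θ s ⋆ FunctionSpaces.Torus.kernel (ε n)) x =
              (θ s ⋆ FunctionSpaces.Torus.gradient (FunctionSpaces.Torus.kernel (ε n))) x :=
            fun x => FunctionSpaces.Torus.gradient_convolution hs.1 (hkS n) x
          simp only [hgrad] at hslice
          exact hslice
      _ ≤ (∫⁻ s, RR n s ^ 2 ∂μT) ^ (1 / 2 : ℝ) * (∫⁻ s, N n s ^ 2 ∂μT) ^ (1 / 2 : ℝ) := hH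
      _ ≤ c n := mul_le_mul' le_rfl (ENNReal.rpow_le_rpow (hND n) (by norm_num))
  have hXr : Tendsto (fun n => ∫ s in Ioo 0 t, (Φ n s + κ * g n s)) atTop (𝓝 0) := by
    have hcR : Tendsto (fun n => (c n).toReal) atTop (𝓝 0) := by
      have := (ENNReal.tendsto_toReal ENNReal.zero_ne_top).comp hc0
      rwa [ENNReal.toReal_zero] at this
    rw [tendsto_zero_iff_norm_tendsto_zero]
    refine squeeze_zero (fun n => norm_nonneg _) (fun n => ?_) hcR
    have h1 := hX n
    rw [← ofReal_norm] at h1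
    exact (ENNReal.ofReal_le_iff_le_toReal (hct n)).1 h1
  -- the dissipation term: `∫_{(0,t)} gₙ → ∫₀ᵗ ‖∇θ‖²`
  have hGlim : Tendsto (fun n => ∫ s in Ioo 0 t, g n s) atTop
      (𝓝 (∫⁻ s in Ioo 0 t, eScalarGradNormSq (θ s)).toReal) := by
    have hDae_t : ∀ᵐ s ∂μt, eScalarGradNormSq (θ s) < ⊤ :=
      ae_restrict_of_ae_restrict_of_subset hsub (hgood.mono fun s hs => hs.2.2.2.2.2)
    have key := tendsto_integral_of_dominated_convergence (μ := μt)
      (fun s => (eScalarGradNormSq (θ s)).toReal) (fun n => (hgm n).mono_measure hle_t)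
      (hGi.mono_measure hle_t)
      (fun n => ae_restrict_of_ae_restrict_of_subset hsub ((hgle n).mono fun s hs => by
        rw [Real.norm_eq_abs, abs_of_nonneg (hg0 n s)]; exact hs))
      (ae_restrict_of_ae_restrict_of_subset hsub hglim)
    rw [integral_toReal (h.aemeasurable_eScalarGradNormSq.mono_measure hle_t) hDae_t] at key
    exact key
  -- the datum and slice terms
  have ha := tendsto_integral_sq_conv_kernel hθ₀
  have hL := tendsto_integral_sq_conv_kernel hδ
  -- the identities in real form
  have hidn : ∀ n : ℕ, ∫ x, (δ ⋆ FunctionSpaces.Torus.kernel (ε n)) x ^ 2 =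
      (∫ x, (θ₀ ⋆ FunctionSpaces.Torus.kernel (ε n)) x ^ 2) + 2 * (∫ s in Ioo 0 t, (Φ n s + κ * g n s)) -
        2 * κ * ∫ s in Ioo 0 t, g n s := by
    intro n
    have hΦi : IntegrableOn (Φ n) (Ioo 0 t) volume :=
      (h.integrableOn_integral_conv_mul_flux (hkS n)).mono_set hsub
    have hgi' : Integrable (g n) μt := (hgi n).mono_measure hle_t
    have e1 : ∫ s in Ioo 0 t, (Φ n s + κ * g n s) = (∫ s in Ioo 0 t, Φ n s) + κ * ∫ s in Ioo 0 t, g n s := by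
      rw [integral_add hΦi (hgi'.const_mul κ), MeasureTheory.integral_const_mul]
    rw [hid n, integral_Ioc_eq_integral_Ioo, e1]
    ring
  have hlim2 : Tendsto (fun n : ℕ => ∫ x, (δ ⋆ FunctionSpaces.Torus.kernel (ε n)) x ^ 2) atTop
      (𝓝 ((∫ x, θ₀ x ^ 2) + 2 * 0 - 2 * κ * (∫⁻ s in Ioo 0 t, eScalarGradNormSq (θ s)).toReal)) := by
    refine (tendsto_congr hidn).2 ?_
    exact (ha.add (hXr.const_mul 2)).sub (hGlim.const_mul (2 * κ))
  have huniq := tendsto_nhds_unique hL hlim2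
  linarith

/-- **Energy EQUALITY at a.e. time for bounded weak passive scalars along `L²` drifts**
(Mescolini–Pitcho–Sorella 2025, Thm. 2.4, (2.3) — printed as an inequality for the constructed
solution; here with equality, Bonicatto–Ciampa–Crippa 2024 Thm. 3.3 / Remark 3.4 in the corner
`p = 2`, `q = ∞`, and for EVERY solution of the class): let `θ` be a weak solution of
`∂ₜθ + u·∇θ = κΔθ` on `T^d × [0,T)` with datum `θ₀ ∈ L²(T^d)`, bounded (`|θ| ≤ M` a.e. on
`(0,T) × T^d`), with `∫₀ᵀ ‖∇θ‖²_{L²} < ∞`, along a drift `u ∈ L²((0,T) × T^d)` weakly divergence free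
at a.e. time. Then for a.e. `t ∈ (0,T)`,
`‖θ(t)‖²_{L²} + 2κ ∫₀ᵗ ‖∇θ(s)‖²_{L²} ds = ‖θ₀‖²_{L²}`. [cite: MescoliniPitchoSorella2025, Thm. 2.4 (2.3), proof pp. 1671–1674] -/
theorem ae_energy_eq_of_abs_le (h : IsWeakScalarTransportOn T κ u θ₀ θ) (hθ₀ : MemLp θ₀ 2 volume)
    {M : ℝ} (hθb : ∀ᵐ t ∂(volume.restrict (Ioo 0 T)), ∀ᵐ x ∂(volume : Measure (UnitAddTorus d)), |θ t x| ≤ M)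
    (hu2 : ∫⁻ t in Ioo 0 T, ∫⁻ x, ‖u t x‖ₑ ^ 2 < ⊤)
    (hD : ∫⁻ t in Ioo 0 T, eScalarGradNormSq (θ t) < ⊤) :
    ∀ᵐ t ∂(volume.restrict (Ioo 0 T)),
      (∫ x, θ t x ^ 2) + 2 * κ * (∫⁻ s in Ioo 0 t, eScalarGradNormSq (θ s)).toReal = ∫ x, θ₀ x ^ 2 := by
  obtain ⟨hε, hε', -⟩ := molRadius_spec
  have hkS : ∀ n : ℕ, FunctionSpaces.Torus.IsSmooth (FunctionSpaces.Torus.kernel (d := d) (1 / (4 * ((n : ℝ) + 1)))) :=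
    fun n => FunctionSpaces.Torus.isSmooth_kernel (hε n) (hε' n)
  have hθ₀i : Integrable θ₀ volume := hθ₀.integrable one_le_two
  have hall := ae_all_iff.2 fun n : ℕ => h.ae_integral_sq_molInt_eq hθ₀i (hkS n)
  filter_upwards [hall, h.ae_memLp_two, ae_restrict_mem measurableSet_Ioo] with t hid hm htT
  exact h.energy_eq_of_molInt_identity hθ₀ hθb hu2 hD ⟨htT.1, htT.2.le⟩ hm hid

/-- `ℝ≥0∞` form of `ae_energy_eq_of_abs_le` for `κ ≥ 0`, in the vocabulary of
`MescoliniPitchoSorella2025_thm24`: for a.e. `t ∈ (0,T)`,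
`ofReal ‖θ(t)‖²_{L²} + 2 · eScalarDissipation κ θ 0 t = ofReal ‖θ₀‖²_{L²}`. [cite: MescoliniPitchoSorella2025, Thm. 2.4 (2.3)] -/
theorem ae_ofReal_scalarL2Sq_add_eq_of_abs_le (h : IsWeakScalarTransportOn T κ u θ₀ θ) (hκ : 0 ≤ κ)
    (hθ₀ : MemLp θ₀ 2 volume)
    {M : ℝ} (hθb : ∀ᵐ t ∂(volume.restrict (Ioo 0 T)), ∀ᵐ x ∂(volume : Measure (UnitAddTorus d)), |θ t x| ≤ M)
    (hu2 : ∫⁻ t in Ioo 0 T, ∫⁻ x, ‖u t x‖ₑ ^ 2 < ⊤)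
    (hD : ∫⁻ t in Ioo 0 T, eScalarGradNormSq (θ t) < ⊤) :
    ∀ᵐ t ∂(volume.restrict (Ioo 0 T)),
      ENNReal.ofReal (scalarL2Sq (θ t)) + 2 * eScalarDissipation κ θ 0 t = ENNReal.ofReal (scalarL2Sq θ₀) := by
  filter_upwards [h.ae_energy_eq_of_abs_le hθ₀ hθb hu2 hD, ae_restrict_mem measurableSet_Ioo] with t ht htT
  have hsub : Ioo 0 t ⊆ Ioo 0 T := Ioo_subset_Ioo_right htT.2.le
  have hfin : ∫⁻ s in Ioo 0 t, eScalarGradNormSq (θ s) ≠ ⊤ :=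
    ((lintegral_mono_set hsub).trans_lt hD).ne
  have hpos : 0 ≤ ∫ x, θ t x ^ 2 := integral_nonneg fun x => sq_nonneg _
  rw [scalarL2Sq, scalarL2Sq, eScalarDissipation, ← ht, ENNReal.ofReal_add hpos (by positivity),
    ENNReal.ofReal_mul (by positivity), ENNReal.ofReal_mul zero_le_two, ENNReal.ofReal_ofNat,
    ENNReal.ofReal_toReal hfin, mul_assoc]

end IsWeakScalarTransportOn

end Torus

end Literature.Analysis.FluidPDE
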